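import Summits.Ventures.LatticeQCDFlow.Exactness.FlowSamplerSymmetrisationDirichlet
import Summits.Ventures.LatticeQCDFlow.Exactness.Phi4FlowSquareIntegrableCeiling
import HarnessLib

/-!
# Row 2's FLOW ARM, SYMMETRISED: `τ_int` OF EVERY EVEN OR ODD POLYNOMIAL OBSERVABLE OF LATTICE φ⁴ — THE OBSERVABLES OF RECORD `E`, `χ₂`, `G(0,0)` INCLUDED — NEVER INCREASES

HONEST FRAMING: exact (Metropolis-corrected) sampling algorithms for lattice gauge theory;
figures of merit are autocorrelation/cost numbers at stated couplings and volumes; no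
continuum-physics claim.  (SCALAR calibration rung S0-A: not a gauge result.)

Venture `LatticeQCDFlow` (cell pub-lqcd), topic `Exactness`; FANOUT row 2 (`s0-phi4`, FLOW arm
`K = imhOpPhi4 J λ q̃`, every `λ > 0`, real `J`, EVERY positive measurable model density with
`∫ q̃ = 1`; symmetrised arm `imhOpPhi4 J λ q̃ₛ`, `q̃ₛ(φ) = ½(q̃(φ) + q̃(−φ))`: propose from the flow, flip
the sign with probability ½, then accept/reject).  NEW WORK of the cell: the lattice instances of the
Dirichlet-form comparison `FlowSamplerSymmetrisationDirichlet.symmetrised_tauInt_le_of_parity`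
(σ = `φ ↦ −φ` preserves Lebesgue measure on `ℝ^Λ`; the φ⁴ weight is even).  S0-A's observables of
record are EVEN (`E` = nearest-neighbour energy, `χ₂ = V·M̄²`, `G(0,0) = (1/V)Σφ²`); the magnetisation
and `Σφ³` are odd.  Nothing is cited as a fact.

## What is proved (`Λ = Fin (n+1)`; `f ∈ PolyObs`, `Var f > 0`, `g = f − ⟨f⟩`)

* **`phi4FlowSym_tauInt_le_of_even`** — `f(−φ) = f(φ)`: if the normalised autocorrelation series of
  `f` under the flow arm is summable, then under the symmetrised arm it is summable and
  **`τ_intₛ(f) ≤ τ_int(f)`**;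
* **`phi4FlowSym_tauInt_le_of_odd`** — the same for `f(−φ) = −f(φ)`;
* **`phi4FlowSym_tauInt_le_of_even_of_gaussian_minorant`** / **`…_of_odd_of_gaussian_minorant`** —
  UNCONDITIONALLY for flows with a Gaussian minorant `q̃ ≥ c e^{−κΣφ²}` (affine couplings with bounded
  log-scales, `Phi4FlowSamplerGaussianMinorant`): both series are summable and
  `τ_intₛ(f) ≤ τ_int(f) ≤ e^{K}/(cZ) − ½`, `K = (n+1)(Σ|J| + κ)²/(4λ)`;
* **`phi4FlowSym_autocov_one_le_of_parity`** — with NO summability hypothesis, the lag-one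
  autocovariance of every parity-homogeneous `f ∈ PolyObs` never increases: `Cₛ_g(1) ≤ C_g(1)`.

Reading for S0-A (no numerics implied): per Metropolis step, the `Z₂`-symmetrised version of ANY flow
sampler of an even action is at least as good on every even and every odd polynomial observable —
energy, susceptibility, two-point function, magnetisation — by the Dirichlet-form ordering; combined
with `FlowSamplerSymmetrisation{,KL,ModeCollapse}`: acceptance, ESS, both KL losses, the overlap, the
sticking column and uniform-ergodicity constants never get worse either.
IN THE TREE, NOT RESTATED: the format-level Peskun–Tierney theorem `ReversibleComparison`
(`RevOp.tauInt_le_of_dirichlet_le`: domination on the WHOLE class and both series summable ⇒ `τ' ≤ τ`)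
does not apply verbatim — the symmetrised/flow pair has Dirichlet domination only on parity sectors,
whence the parity-part reduction of `FlowSamplerSymmetrisationDirichlet`, which also derives the
symmetrised series' summability; the parity-blind companion is row 4's model-domination bound
`IMHTauIntModelComparison.imhOp_tauInt_le_of_model_ge` (`q̃ₛ ≥ ½ q̃` ⇒ `τₛ + ½ ≤ 2(τ + ½)` for bounded
`g` of any parity).  PRIOR ART NAMED (not cited as a fact): the symmetrised proposal is the
'single-model symmetrized mixture' of Boyda et al. 2021 / Hackett et al. 2021 §4.2, used there
empirically; the ordering is Peskun 1973 / Tierney 1998 in shape, and Tierney 1998 Prop. 5 (mixture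
proposal ⪰ mixture of kernels; tree: `Literature.Probability.MarkovChains.MixtureProposalPeskun`) is
the nearest printed statement — it compares `K_{q̃ₛ}` with `½(K_q̃ + ΣK_q̃Σ)`, not with `K_q̃`.  NOT CLAIMED: any value for any network; per-COST comparison (the symmetrised proposal evaluates the
model density twice); observables of mixed parity; anything for the HMC / local arms.
-/

namespace Summit.Ventures.LatticeQCDFlow.Exactness

open Real MeasureTheory Filter Finset Set Topology
open Summit.Ventures.LatticeQCDFlow.Scoring

section Lattice

variable {n : ℕ}

/-- An odd observable has `⟨f⟩ = 0` under the even Gibbs weight. -/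
theorem gibbsExpect_eq_zero_of_odd (J : Fin (n + 1) → Fin (n + 1) → ℝ) (lam : ℝ)
    {f : (Fin (n + 1) → ℝ) → ℝ} (hodd : ∀ φ, f (-φ) = -f φ) : gibbsExpect J lam f = 0 := by
  haveI := isNegInvariant_volume_pi (Λ := Fin (n + 1))
  have h := integral_neg_eq_self (fun φ : Fin (n + 1) → ℝ => f φ * gibbsWeight J lam φ) volume
  have e : (fun φ : Fin (n + 1) → ℝ => f (-φ) * gibbsWeight J lam (-φ))
      = fun φ => -(f φ * gibbsWeight J lam φ) := by
    funext φ
    rw [hodd, gibbsWeight_neg]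
    ring
  rw [e, integral_neg] at h
  unfold gibbsExpect
  rw [show (∫ φ : Fin (n + 1) → ℝ, f φ * gibbsWeight J lam φ) = 0 by linarith, zero_div]

/-- The lattice form of the comparison for a centred observable of parity `c` (`c² = 1`). -/
theorem phi4FlowSym_tauInt_le_of_parity {lam : ℝ} (hlam : 0 < lam)
    (J : Fin (n + 1) → Fin (n + 1) → ℝ) {q : (Fin (n + 1) → ℝ) → ℝ} (hq0 : ∀ φ, 0 < q φ)
    (hqm : Measurable q) (hqi : Integrable q) (hq1 : ∫ φ, q φ = 1) {f : (Fin (n + 1) → ℝ) → ℝ}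
    (hf : PolyObs f) (hP : 0 < ∫ φ, (f φ - gibbsExpect J lam f) ^ 2 * gibbsWeight J lam φ)
    {c : ℝ} (hc : c ^ 2 = 1)
    (hpar : ∀ φ, f (-φ) - gibbsExpect J lam f = c * (f φ - gibbsExpect J lam f))
    (hs : Summable fun k => (∫ φ, (f φ - gibbsExpect J lam f)
        * ((imhOpPhi4 J lam q)^[k + 1] (fun ψ => f ψ - gibbsExpect J lam f)) φ * gibbsWeight J lam φ)
        / ∫ φ, (f φ - gibbsExpect J lam f) ^ 2 * gibbsWeight J lam φ) :
    (Summable fun k => (∫ φ, (f φ - gibbsExpect J lam f)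
        * ((imhOpPhi4 J lam (fun ψ => (q ψ + q (-ψ)) / 2))^[k + 1]
            (fun ψ => f ψ - gibbsExpect J lam f)) φ * gibbsWeight J lam φ)
        / ∫ φ, (f φ - gibbsExpect J lam f) ^ 2 * gibbsWeight J lam φ) ∧
    tauInt (fun k => (∫ φ, (f φ - gibbsExpect J lam f)
        * ((imhOpPhi4 J lam (fun ψ => (q ψ + q (-ψ)) / 2))^[k]
            (fun ψ => f ψ - gibbsExpect J lam f)) φ * gibbsWeight J lam φ)
        / ∫ φ, (f φ - gibbsExpect J lam f) ^ 2 * gibbsWeight J lam φ)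
      ≤ tauInt (fun k => (∫ φ, (f φ - gibbsExpect J lam f)
        * ((imhOpPhi4 J lam q)^[k] (fun ψ => f ψ - gibbsExpect J lam f)) φ * gibbsWeight J lam φ)
        / ∫ φ, (f φ - gibbsExpect J lam f) ^ 2 * gibbsWeight J lam φ) := by
  obtain ⟨hgm, hg2⟩ := polyObs_sq_integrable hlam J (polyObs_sub_const hf (gibbsExpect J lam f))
  haveI := isNegInvariant_volume_pi (Λ := Fin (n + 1))
  rw [imhOpPhi4_eq_imhOp] at hs ⊢
  rw [imhOpPhi4_eq_imhOp]
  exact symmetrised_tauInt_le_of_parity (μ := volume) (σ := fun ψ : Fin (n + 1) → ℝ => -ψ)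
    (Measure.measurePreserving_neg volume) (fun φ => neg_neg φ) (fun φ => gibbsWeight_pos J lam φ)
    (continuous_gibbsWeight J lam).measurable (integrable_gibbsWeight hlam J)
    (fun φ => gibbsWeight_neg J lam φ) hq0 hqm hqi hq1 hgm hg2 hP hc hpar hs

/-- **SYMMETRISING NEVER INCREASES `τ_int` OF AN EVEN POLYNOMIAL OBSERVABLE** (energy `E`, `χ₂`,
`G(0,0)`, `M²`, …): every `λ > 0`, real `J`, positive measurable model density with `∫ q̃ = 1`;
`f ∈ PolyObs`, `f(−φ) = f(φ)`, `Var f > 0`; if the normalised autocorrelation series of `f` under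
`imhOpPhi4 J λ q̃` is summable, then under `imhOpPhi4 J λ q̃ₛ` it is summable and `τ_intₛ(f) ≤ τ_int(f)`. -/
theorem phi4FlowSym_tauInt_le_of_even {lam : ℝ} (hlam : 0 < lam)
    (J : Fin (n + 1) → Fin (n + 1) → ℝ) {q : (Fin (n + 1) → ℝ) → ℝ} (hq0 : ∀ φ, 0 < q φ)
    (hqm : Measurable q) (hqi : Integrable q) (hq1 : ∫ φ, q φ = 1) {f : (Fin (n + 1) → ℝ) → ℝ}
    (hf : PolyObs f) (heven : ∀ φ, f (-φ) = f φ)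
    (hP : 0 < ∫ φ, (f φ - gibbsExpect J lam f) ^ 2 * gibbsWeight J lam φ)
    (hs : Summable fun k => (∫ φ, (f φ - gibbsExpect J lam f)
        * ((imhOpPhi4 J lam q)^[k + 1] (fun ψ => f ψ - gibbsExpect J lam f)) φ * gibbsWeight J lam φ)
        / ∫ φ, (f φ - gibbsExpect J lam f) ^ 2 * gibbsWeight J lam φ) :
    (Summable fun k => (∫ φ, (f φ - gibbsExpect J lam f)
        * ((imhOpPhi4 J lam (fun ψ => (q ψ + q (-ψ)) / 2))^[k + 1]
            (fun ψ => f ψ - gibbsExpect J lam f)) φ * gibbsWeight J lam φ)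
        / ∫ φ, (f φ - gibbsExpect J lam f) ^ 2 * gibbsWeight J lam φ) ∧
    tauInt (fun k => (∫ φ, (f φ - gibbsExpect J lam f)
        * ((imhOpPhi4 J lam (fun ψ => (q ψ + q (-ψ)) / 2))^[k]
            (fun ψ => f ψ - gibbsExpect J lam f)) φ * gibbsWeight J lam φ)
        / ∫ φ, (f φ - gibbsExpect J lam f) ^ 2 * gibbsWeight J lam φ)
      ≤ tauInt (fun k => (∫ φ, (f φ - gibbsExpect J lam f)
        * ((imhOpPhi4 J lam q)^[k] (fun ψ => f ψ - gibbsExpect J lam f)) φ * gibbsWeight J lam φ)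
        / ∫ φ, (f φ - gibbsExpect J lam f) ^ 2 * gibbsWeight J lam φ) :=
  phi4FlowSym_tauInt_le_of_parity hlam J hq0 hqm hqi hq1 hf hP (c := 1) (by norm_num)
    (fun φ => by rw [heven φ, one_mul]) hs

/-- **… NOR OF AN ODD ONE** (the magnetisation, `Σφ³`, a staggered magnetisation): `f(−φ) = −f(φ)`. -/
theorem phi4FlowSym_tauInt_le_of_odd {lam : ℝ} (hlam : 0 < lam)
    (J : Fin (n + 1) → Fin (n + 1) → ℝ) {q : (Fin (n + 1) → ℝ) → ℝ} (hq0 : ∀ φ, 0 < q φ)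
    (hqm : Measurable q) (hqi : Integrable q) (hq1 : ∫ φ, q φ = 1) {f : (Fin (n + 1) → ℝ) → ℝ}
    (hf : PolyObs f) (hodd : ∀ φ, f (-φ) = -f φ)
    (hP : 0 < ∫ φ, (f φ - gibbsExpect J lam f) ^ 2 * gibbsWeight J lam φ)
    (hs : Summable fun k => (∫ φ, (f φ - gibbsExpect J lam f)
        * ((imhOpPhi4 J lam q)^[k + 1] (fun ψ => f ψ - gibbsExpect J lam f)) φ * gibbsWeight J lam φ)
        / ∫ φ, (f φ - gibbsExpect J lam f) ^ 2 * gibbsWeight J lam φ) :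
    (Summable fun k => (∫ φ, (f φ - gibbsExpect J lam f)
        * ((imhOpPhi4 J lam (fun ψ => (q ψ + q (-ψ)) / 2))^[k + 1]
            (fun ψ => f ψ - gibbsExpect J lam f)) φ * gibbsWeight J lam φ)
        / ∫ φ, (f φ - gibbsExpect J lam f) ^ 2 * gibbsWeight J lam φ) ∧
    tauInt (fun k => (∫ φ, (f φ - gibbsExpect J lam f)
        * ((imhOpPhi4 J lam (fun ψ => (q ψ + q (-ψ)) / 2))^[k]
            (fun ψ => f ψ - gibbsExpect J lam f)) φ * gibbsWeight J lam φ)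
        / ∫ φ, (f φ - gibbsExpect J lam f) ^ 2 * gibbsWeight J lam φ)
      ≤ tauInt (fun k => (∫ φ, (f φ - gibbsExpect J lam f)
        * ((imhOpPhi4 J lam q)^[k] (fun ψ => f ψ - gibbsExpect J lam f)) φ * gibbsWeight J lam φ)
        / ∫ φ, (f φ - gibbsExpect J lam f) ^ 2 * gibbsWeight J lam φ) :=
  phi4FlowSym_tauInt_le_of_parity hlam J hq0 hqm hqi hq1 hf hP (c := -1) (by norm_num)
    (fun φ => by rw [hodd φ, gibbsExpect_eq_zero_of_odd J lam hodd]; ring) hs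

/-- **UNCONDITIONALLY UNDER A GAUSSIAN MINORANT OF THE MODEL** (`q̃ ≥ c e^{−κΣφ²}`, `c > 0`): for every
EVEN `f ∈ PolyObs` with `Var f > 0` both series are summable and
`τ_intₛ(f) ≤ τ_int(f) ≤ e^{K}/(cZ) − ½`, `K = (n+1)(Σ|J| + κ)²/(4λ)`. -/
theorem phi4FlowSym_tauInt_le_of_even_of_gaussian_minorant {lam : ℝ} (hlam : 0 < lam)
    (J : Fin (n + 1) → Fin (n + 1) → ℝ) {q : (Fin (n + 1) → ℝ) → ℝ} (hq0 : ∀ φ, 0 < q φ)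
    (hqm : Measurable q) (hqi : Integrable q) (hq1 : ∫ φ, q φ = 1) {c₀ κ : ℝ} (hc₀ : 0 < c₀)
    (hqc : ∀ φ, c₀ * Real.exp (-(κ * ∑ w, φ w ^ 2)) ≤ q φ) {f : (Fin (n + 1) → ℝ) → ℝ}
    (hf : PolyObs f) (heven : ∀ φ, f (-φ) = f φ)
    (hP : 0 < ∫ φ, (f φ - gibbsExpect J lam f) ^ 2 * gibbsWeight J lam φ) :
    (Summable fun k => (∫ φ, (f φ - gibbsExpect J lam f)
        * ((imhOpPhi4 J lam (fun ψ => (q ψ + q (-ψ)) / 2))^[k + 1]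
            (fun ψ => f ψ - gibbsExpect J lam f)) φ * gibbsWeight J lam φ)
        / ∫ φ, (f φ - gibbsExpect J lam f) ^ 2 * gibbsWeight J lam φ) ∧
    tauInt (fun k => (∫ φ, (f φ - gibbsExpect J lam f)
        * ((imhOpPhi4 J lam (fun ψ => (q ψ + q (-ψ)) / 2))^[k]
            (fun ψ => f ψ - gibbsExpect J lam f)) φ * gibbsWeight J lam φ)
        / ∫ φ, (f φ - gibbsExpect J lam f) ^ 2 * gibbsWeight J lam φ)
      ≤ tauInt (fun k => (∫ φ, (f φ - gibbsExpect J lam f)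
        * ((imhOpPhi4 J lam q)^[k] (fun ψ => f ψ - gibbsExpect J lam f)) φ * gibbsWeight J lam φ)
        / ∫ φ, (f φ - gibbsExpect J lam f) ^ 2 * gibbsWeight J lam φ) ∧
    tauInt (fun k => (∫ φ, (f φ - gibbsExpect J lam f)
        * ((imhOpPhi4 J lam q)^[k] (fun ψ => f ψ - gibbsExpect J lam f)) φ * gibbsWeight J lam φ)
        / ∫ φ, (f φ - gibbsExpect J lam f) ^ 2 * gibbsWeight J lam φ)
      ≤ Real.exp ((n + 1) * (((∑ y, ∑ z, |J y z|) + κ) ^ 2 / (4 * lam))) / c₀ / gibbsZ J lam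
        - 1 / 2 := by
  obtain ⟨hs, hceil⟩ := phi4Flow_tauInt_le_weightBound_poly hlam J hq0 hqm hqi hq1
    (gibbsWeight_le_of_gaussian_minorant hlam J hc₀ hqc) hf hP
  obtain ⟨hss, hle⟩ := phi4FlowSym_tauInt_le_of_even hlam J hq0 hqm hqi hq1 hf heven hP hs
  exact ⟨hss, hle, hceil⟩

/-- **… AND FOR EVERY ODD `f ∈ PolyObs`** under the same Gaussian minorant. -/
theorem phi4FlowSym_tauInt_le_of_odd_of_gaussian_minorant {lam : ℝ} (hlam : 0 < lam)
    (J : Fin (n + 1) → Fin (n + 1) → ℝ) {q : (Fin (n + 1) → ℝ) → ℝ} (hq0 : ∀ φ, 0 < q φ)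
    (hqm : Measurable q) (hqi : Integrable q) (hq1 : ∫ φ, q φ = 1) {c₀ κ : ℝ} (hc₀ : 0 < c₀)
    (hqc : ∀ φ, c₀ * Real.exp (-(κ * ∑ w, φ w ^ 2)) ≤ q φ) {f : (Fin (n + 1) → ℝ) → ℝ}
    (hf : PolyObs f) (hodd : ∀ φ, f (-φ) = -f φ)
    (hP : 0 < ∫ φ, (f φ - gibbsExpect J lam f) ^ 2 * gibbsWeight J lam φ) :
    (Summable fun k => (∫ φ, (f φ - gibbsExpect J lam f)
        * ((imhOpPhi4 J lam (fun ψ => (q ψ + q (-ψ)) / 2))^[k + 1]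
            (fun ψ => f ψ - gibbsExpect J lam f)) φ * gibbsWeight J lam φ)
        / ∫ φ, (f φ - gibbsExpect J lam f) ^ 2 * gibbsWeight J lam φ) ∧
    tauInt (fun k => (∫ φ, (f φ - gibbsExpect J lam f)
        * ((imhOpPhi4 J lam (fun ψ => (q ψ + q (-ψ)) / 2))^[k]
            (fun ψ => f ψ - gibbsExpect J lam f)) φ * gibbsWeight J lam φ)
        / ∫ φ, (f φ - gibbsExpect J lam f) ^ 2 * gibbsWeight J lam φ)
      ≤ tauInt (fun k => (∫ φ, (f φ - gibbsExpect J lam f)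
        * ((imhOpPhi4 J lam q)^[k] (fun ψ => f ψ - gibbsExpect J lam f)) φ * gibbsWeight J lam φ)
        / ∫ φ, (f φ - gibbsExpect J lam f) ^ 2 * gibbsWeight J lam φ) ∧
    tauInt (fun k => (∫ φ, (f φ - gibbsExpect J lam f)
        * ((imhOpPhi4 J lam q)^[k] (fun ψ => f ψ - gibbsExpect J lam f)) φ * gibbsWeight J lam φ)
        / ∫ φ, (f φ - gibbsExpect J lam f) ^ 2 * gibbsWeight J lam φ)
      ≤ Real.exp ((n + 1) * (((∑ y, ∑ z, |J y z|) + κ) ^ 2 / (4 * lam))) / c₀ / gibbsZ J lam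
        - 1 / 2 := by
  obtain ⟨hs, hceil⟩ := phi4Flow_tauInt_le_weightBound_poly hlam J hq0 hqm hqi hq1
    (gibbsWeight_le_of_gaussian_minorant hlam J hc₀ hqc) hf hP
  obtain ⟨hss, hle⟩ := phi4FlowSym_tauInt_le_of_odd hlam J hq0 hqm hqi hq1 hf hodd hP hs
  exact ⟨hss, hle, hceil⟩

/-! ## Unconditional: the lag-one autocorrelation -/

/-- **WITHOUT ANY SUMMABILITY HYPOTHESIS, THE LAG-ONE AUTOCOVARIANCE NEVER INCREASES** for a
parity-homogeneous `f ∈ PolyObs` (`f(−φ) − ⟨f⟩ = c (f(φ) − ⟨f⟩)`, `c² = 1`): `Cₛ_g(1) ≤ C_g(1)`,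
`g = f − ⟨f⟩` — the Dirichlet-form domination `𝓔ₛ(g) ≥ 𝓔_q(g)` read at `v = g`. -/
theorem phi4FlowSym_autocov_one_le_of_parity {lam : ℝ} (hlam : 0 < lam)
    (J : Fin (n + 1) → Fin (n + 1) → ℝ) {q : (Fin (n + 1) → ℝ) → ℝ} (hq0 : ∀ φ, 0 < q φ)
    (hqm : Measurable q) (hqi : Integrable q) (hq1 : ∫ φ, q φ = 1) {f : (Fin (n + 1) → ℝ) → ℝ}
    (hf : PolyObs f) {c : ℝ} (hc : c ^ 2 = 1)
    (hpar : ∀ φ, f (-φ) - gibbsExpect J lam f = c * (f φ - gibbsExpect J lam f)) :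
    ∫ φ, (f φ - gibbsExpect J lam f)
        * imhOpPhi4 J lam (fun ψ => (q ψ + q (-ψ)) / 2) (fun ψ => f ψ - gibbsExpect J lam f) φ
        * gibbsWeight J lam φ
      ≤ ∫ φ, (f φ - gibbsExpect J lam f)
        * imhOpPhi4 J lam q (fun ψ => f ψ - gibbsExpect J lam f) φ * gibbsWeight J lam φ := by
  obtain ⟨hgm, hg2⟩ := polyObs_sq_integrable hlam J (polyObs_sub_const hf (gibbsExpect J lam f))
  haveI := isNegInvariant_volume_pi (Λ := Fin (n + 1))
  have h := symmetrised_dirichlet_ge_of_parity (μ := volume) (σ := fun ψ : Fin (n + 1) → ℝ => -ψ)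
    (Measure.measurePreserving_neg volume) (fun φ => neg_neg φ) (fun φ => gibbsWeight_pos J lam φ)
    (continuous_gibbsWeight J lam).measurable (integrable_gibbsWeight hlam J)
    (fun φ => gibbsWeight_neg J lam φ) hq0 hqm hqi hq1 hgm hg2 hc hpar
  rw [imhOpPhi4_eq_imhOp, imhOpPhi4_eq_imhOp]
  linarith

end Lattice

end Summit.Ventures.LatticeQCDFlow.Exactness
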